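import Literature.Analysis.Complex.JensenPolynomialCircleKernelDetection
import HarnessLib

/-!
# The exact circle kernel of `J^{d,0}_γ(z/d)`, III: rows `n ≥ 1` — the local detection criterion
# for the zeros of `F⁽ⁿ⁾` (all proved)

Trunk T-CA, namespace `Literature.Analysis.Complex.JensenCircleKernel` (continued). The shift
`J^{d,n}_γ = J^{d,0}_{γ(n+·)}` (`jensenPoly_shift`; Craven–Csordas' `g_{n,p}`) and the
summability of the shifted majorant (`summable_shift_majorant`) turn Part II's criterion into the
same statement in row `n`: a disc in the open upper half-plane containing a zero of `F⁽ⁿ⁾` on whose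
boundary the local error functional of `F⁽ⁿ⁾` is `< |F⁽ⁿ⁾|` makes `J^{d,n}_γ` non-hyperbolic
(`not_splits_jensenPoly_row_of_local_criterion`).

Provenance: cell rh-jensen (D-0074 GROUP I, negation lens round 3, `NegationLensR3Sketch.lean`
§§1–5c, planner-rh-jensen-idea-2-g3-0, 2026-08-26; farm rc 0, sorry-free), landed by
prover-rh-jensen-eng-2-g2-0 (WANTED W1 of that seat). AI-produced formalisation; AI review is weaker
than expert review. RH-free: everything is analysis of an arbitrary real sequence `γ` / entire `F`;
nothing here concerns `ξ` or bears on the truth of RH.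

## References
* [CampbellJalowy2026] A. Campbell, J. Jalowy, *Pólya–Schur problems and free probability*,
  arXiv:2605.31356 (2026), p. 9: the contour (saddle-point) representation of the Appell polynomials
  `A_{n,f}(z) = (n!/2πi)∮_Γ f(x)e^{xz}x^{-n-1}dx` (classical); read on the circle `|x| = |z|` after
  `w ↦ w/d` it is the kernel representation below.
* [CravenCsordas1989] T. Craven, G. Csordas, Pacific J. Math. 136 (1989) 241–260, Lemma 2.2 (the
  qualitative `J^{d,0}_γ(z/d) → F(z)`; its proof's multipliers `u_d(k) = d!/((d−k)! dᵏ)`).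
* [Conway1978] J. B. Conway, *Functions of One Complex Variable I*, Ch. IV §2 (Taylor), Ch. V §3
  (Rouché / argument principle; tree: `Literature.Analysis.Complex.ArgumentPrincipleWinding`).
* [GORZPNAS2019] M. Griffin, K. Ono, L. Rolen, D. Zagier, PNAS 116 (2019) 11103–11110, §1 (`J^{d,n}_γ`).
-/

noncomputable section

open Polynomial Complex Filter Topology Metric Set MeasureTheory intervalIntegral
open scoped ComplexConjugate Nat Real

namespace Literature.Analysis.Complex.JensenCircleKernel

open Literature.NumberTheory.LFunctions Literature.Analysis.Complex.PolyaSchur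
  Literature.Analysis.Complex Literature.Topology.PlaneTopology

/-! ## §5c Rows `n ≥ 1`: the same criterion for the zeros of `F⁽ⁿ⁾` -/

/-- Shift identity: `J^{d,n}_γ = J^{d,0}_{γ(n+·)}`.
[cite: CravenCsordas1989, §2 (g_{n,p}(t) = Σ (n choose k) γ_{k+p} t^k)] -/
theorem jensenPoly_shift (γ : ℕ → ℝ) (d n : ℕ) :
    jensenPoly γ d n = jensenPoly (fun j => γ (n + j)) d 0 := by
  simp [jensenPoly]

/-- The majorant of the shifted sequence converges everywhere if the original one does:
`Σⱼ |γ(n+j)| Rʲ/j! < ∞` (from `(n+j)!/j! ≤ n!·2^{n+j}`).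
[cite: CravenCsordas1989, proof of Lemma 2.2 (majorant series of the derivatives)] -/
theorem summable_shift_majorant {γ : ℕ → ℝ}
    (hsum : ∀ R : ℝ, 0 ≤ R → Summable fun j => |γ j| / (j ! : ℝ) * R ^ j) (n : ℕ)
    (R : ℝ) (hR : 0 ≤ R) :
    Summable fun j => |γ (n + j)| / (j ! : ℝ) * R ^ j := by
  -- compare with the tail of the majorant at radius 2R (reindexed by j ↦ n + j)
  have hR' : 1 ≤ max R 1 := le_max_right _ _
  have hRR' : R ≤ max R 1 := le_max_left _ _
  have h2 := (hsum (2 * max R 1) (by positivity)).comp_injective (add_right_injective n)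
  refine Summable.of_nonneg_of_le (fun j => by positivity) (fun j => ?_) (h2.mul_left ((n ! : ℝ) * 1))
  simp only [Function.comp]
  have hj : (0 : ℝ) < j ! := by exact_mod_cast Nat.factorial_pos j
  have hnj : (0 : ℝ) < (n + j)! := by exact_mod_cast Nat.factorial_pos (n + j)
  -- (n+j)! ≤ n! j! 2^{n+j}  (from `Nat.add_choose_le` / `choose ≤ 2^`)
  have hchoose : ((n + j)! : ℝ) ≤ (n ! : ℝ) * (j ! : ℝ) * 2 ^ (n + j) := by
    have h1 : (n + j).choose n ≤ 2 ^ (n + j) := Nat.choose_le_two_pow _ _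
    have h2' : (n + j)! = (n + j).choose n * (n ! * j !) := by
      rw [Nat.choose_eq_factorial_div_factorial (Nat.le_add_right n j), Nat.add_sub_cancel_left,
        Nat.div_mul_cancel (Nat.factorial_mul_factorial_dvd_factorial_add n j)]
    calc ((n + j)! : ℝ) = ((n + j).choose n : ℝ) * ((n ! : ℝ) * (j ! : ℝ)) := by
          exact_mod_cast congrArg (Nat.cast (R := ℝ)) h2'
      _ ≤ (2 : ℝ) ^ (n + j) * ((n ! : ℝ) * (j ! : ℝ)) := by
          gcongr; exact_mod_cast h1
      _ = (n ! : ℝ) * (j ! : ℝ) * 2 ^ (n + j) := by ring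
  rw [div_mul_eq_mul_div, div_le_iff₀ hj]
  calc |γ (n + j)| * R ^ j
      = |γ (n + j)| / ((n + j)! : ℝ) * R ^ j * ((n + j)! : ℝ) := by field_simp
    _ ≤ |γ (n + j)| / ((n + j)! : ℝ) * R ^ j * ((n ! : ℝ) * (j ! : ℝ) * 2 ^ (n + j)) := by
          gcongr
    _ = (n ! : ℝ) * 1 * (|γ (n + j)| / ((n + j)! : ℝ) * (2 ^ n * (2 * R) ^ j)) * (j ! : ℝ) := by
          rw [mul_pow, pow_add]; ring
    _ ≤ (n ! : ℝ) * 1 * (|γ (n + j)| / ((n + j)! : ℝ) * (2 * max R 1) ^ (n + j)) * (j ! : ℝ) := by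
          have hpow : (2 : ℝ) ^ n * (2 * R) ^ j ≤ (2 * max R 1) ^ (n + j) := by
            rw [pow_add]
            exact mul_le_mul (pow_le_pow_left₀ (by norm_num) (by linarith) n)
              (pow_le_pow_left₀ (by positivity) (by linarith) j) (by positivity) (by positivity)
          gcongr

/-- **The local detection criterion in row `n`.** `J^{d,n}_γ(z/d) = ∫ F⁽ⁿ⁾(ze^{iτ})K_d(τ)dτ` with
`F⁽ⁿ⁾(w) = Σⱼ γ(n+j)wʲ/j!` (here any `Fn` with that expansion): a disc `B(c,r)`, `r < |Im c|`,
containing a zero of `F⁽ⁿ⁾` on whose boundary `localErr_d(F⁽ⁿ⁾, ·) < |F⁽ⁿ⁾|` makes `J^{d,n}_γ`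
non-hyperbolic. So row `n` sees exactly the NON-REAL ZEROS OF `F⁽ⁿ⁾` that are `d`-locally
detectable — the planted pair is visible in row `n` as long as it survives `n` differentiations
(local Pólya–Wiman dynamics; memo §3, `toy-r3/footprint.py`).
[cite: Conway1978, Ch. V §3 (Rouché)] [cite: CravenCsordas1989, Lemma 2.2] -/
theorem not_splits_jensenPoly_row_of_local_criterion {γ : ℕ → ℝ} {Fn : ℂ → ℂ} (n : ℕ)
    (hFn : ∀ w : ℂ, HasSum (fun j => (γ (n + j) : ℂ) / (j ! : ℂ) * w ^ j) (Fn w))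
    (hsum : ∀ R : ℝ, 0 ≤ R → Summable fun j => |γ j| / (j ! : ℝ) * R ^ j)
    (hFd : Differentiable ℂ Fn) {c η₀ : ℂ} {r : ℝ} (hr : 0 < r) (hrim : r < |c.im|)
    (hη₀ : ‖η₀ - c‖ < r) (hFη₀ : Fn η₀ = 0) {d : ℕ} (hd : 0 < d)
    (hloc : ∀ w : ℂ, ‖w - c‖ = r → localErr Fn d w < ‖Fn w‖) :
    ¬ (jensenPoly γ d n).Splits := by
  rw [jensenPoly_shift]
  exact not_splits_jensenPoly_of_local_criterion (γ := fun j => γ (n + j)) hFn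
    (summable_shift_majorant hsum n) hFd hr hrim hη₀ hFη₀ hd hloc

end Literature.Analysis.Complex.JensenCircleKernel
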